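import Mathlib
import HarnessLib
import Summits.NavierStokesRegularity.NavierStokesRegularity.Theses.TypeICertificateLadder
import Literature.Analysis.FluidPDE.VectorCalculus

/-!
# Sketch — crux-ideate stmt-NavierStokesRegularity-2881 (TypeIConcentration), ideator 2, round 1

First lemmas of the two idea cards (they only need to ELABORATE; nothing is proved here):

* card `oseen-tail-calm-core-confinement`: `CalmCorePersistence` (PROP M), `HotSpotConfinement`,
  `TypeIGradientBound`, `HotPointNearFixedCentre`;
* card `reach-shielded-core-regularity`: `CalmCoreRegularity`, `TypeIVorticityFloor`.

All statements are over accepted declarations (`IsClassicalNSSolutionOn`, `IsLerayHopfOn`,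
`HasRapidSpatialDecay`, `HasSmoothExtensionPast`, `curl`) and keep the crux's hypothesis bundle
verbatim, so that the glue to `TypeICertificateLadder.TypeIConcentration` is by specialisation.
-/

namespace Summit.NavierStokesRegularity.NavierStokesRegularity.Cruxes.TypeIConcentration.Sketch

open scoped Topology
open Filter Set MeasureTheory Literature.Analysis.FluidPDE

local notation "ℝ³" => EuclideanSpace ℝ (Fin 3)

/-- The crux's standing hypothesis bundle on `(ν, T, u, p)` with Type-I constant `C`:
classical on `[0,T)`, Leray–Hopf from `u 0`, rapidly decaying datum, eventual dimensionless rate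
`√(T−t)‖u(t,x)‖ ≤ C√ν`. -/
def TypeIData (C ν T : ℝ) (u : ℝ → ℝ³ → ℝ³) (p : ℝ → ℝ³ → ℝ) : Prop :=
  IsClassicalNSSolutionOn (Set.Ico 0 T) ν 0 u p ∧ IsLerayHopfOn T ν 0 (u 0) u ∧
    HasRapidSpatialDecay (u 0) ∧ ∀ᶠ t in 𝓝[<] T, ∀ x, Real.sqrt (T - t) * ‖u t x‖ ≤ C * Real.sqrt ν

/-- CARD 1, FIRST LEMMA (PROP M, "calm similarity cores persist"). For every Type-I constant `C`
and every output threshold `η > 0` there are an input calmness `ε > 0` and a similarity radius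
`ρ > 0` such that: if at some time `t₁` (late enough) the velocity is `ε`-calm in similarity units
on the ball `B(x₀, ρ√(ν(T−t₁)))`, then it stays `η`-calm on the shrinking similarity balls
`B(x₀, (ρ/2)√(ν(T−t)))` for ALL later `t < T`. Proof route: mild (Oseen) formula from `t₁`;
far field bounded by the Type-I rate and integrated against the kernel tail
`|∇𝒪_τ(z)| ≲ (|z|+√τ)⁻⁴` gives `≤ K C²(1+log ρ)/(ρ√(T−t))`; near field quadratic bootstrap;
explicit `ρ(C,η) ≈ K' C² log C / η`. -/
def CalmCorePersistence : Prop :=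
  ∀ C : ℝ, 0 < C → ∀ η : ℝ, 0 < η → ∃ ε : ℝ, 0 < ε ∧ ∃ ρ : ℝ, 0 < ρ ∧
    ∀ (ν T : ℝ), 0 < ν → 0 < T → ∀ (u : ℝ → ℝ³ → ℝ³) (p : ℝ → ℝ³ → ℝ), TypeIData C ν T u p →
      ∀ᶠ t₁ in 𝓝[<] T, ∀ x₀ : ℝ³,
        (∀ x ∈ Metric.ball x₀ (ρ * Real.sqrt (ν * (T - t₁))),
            Real.sqrt (T - t₁) * ‖u t₁ x‖ ≤ ε * Real.sqrt ν) →
        ∀ t ∈ Set.Ico t₁ T, ∀ x ∈ Metric.ball x₀ (ρ / 2 * Real.sqrt (ν * (T - t))),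
            Real.sqrt (T - t) * ‖u t x‖ ≤ η * Real.sqrt ν

/-- CARD 1, consequence used in the assembly ("hot spots are forward-confined"): an `η`-hot
point at a later time `t` lies within `ρ√(ν(T−t₁))` of an `ε`-hot point at any earlier (late
enough) time `t₁` — the contrapositive of `CalmCorePersistence` at the centre `x₀ := ` the hot
point itself. Pure logic from PROP M; recorded to fix the shape. -/
def HotSpotConfinement : Prop :=
  ∀ C : ℝ, 0 < C → ∀ η : ℝ, 0 < η → ∃ ε : ℝ, 0 < ε ∧ ∃ ρ : ℝ, 0 < ρ ∧
    ∀ (ν T : ℝ), 0 < ν → 0 < T → ∀ (u : ℝ → ℝ³ → ℝ³) (p : ℝ → ℝ³ → ℝ), TypeIData C ν T u p →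
      ∀ᶠ t₁ in 𝓝[<] T, ∀ t ∈ Set.Ico t₁ T, ∀ z : ℝ³,
        η * Real.sqrt ν < Real.sqrt (T - t) * ‖u t z‖ →
        ∃ w ∈ Metric.ball z (ρ * Real.sqrt (ν * (T - t₁))),
          ε * Real.sqrt ν < Real.sqrt (T - t₁) * ‖u t₁ w‖

/-- CARD 1, support (KNSS bounded-mild gradient bound, scale-invariant form): a Type-I(`C`)
velocity has Type-I gradient with a constant `C₁(C)` depending on `C` only
(`|∇u(t,x)| ≤ C₁ √ν… ` in the units below: `(T−t)‖∇u(t,x)‖ ≤ C₁`). In print: KNSS 2009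
(bounded mild solutions have bounded gradients, constants depending on the bound and the time
lag); in tree `IsKNSSDriftMild.exists_gradient_bound` / `KNSS2009_mild_regularity_of_prop41`. -/
def TypeIGradientBound : Prop :=
  ∀ C : ℝ, 0 < C → ∃ C₁ : ℝ, 0 < C₁ ∧
    ∀ (ν T : ℝ), 0 < ν → 0 < T → ∀ (u : ℝ → ℝ³ → ℝ³) (p : ℝ → ℝ³ → ℝ), TypeIData C ν T u p →
      ∀ᶠ t in 𝓝[<] T, ∀ x : ℝ³, (T - t) * ‖fderiv ℝ (u t) x‖ ≤ C₁

/-- CARD 1, the selection statement the assembly proves from `HotSpotConfinement` + Leray's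
`L^∞` rate (`leray_blowup_rate_top`, in tree) + compactness (limit point of hot points): at a
Type-I(`C`) blow-up there is a FIXED centre `x₀` which, at every late time, has an `ε(C)`-hot
point within `ρ(C)√(ν(T−t))`. With `TypeIGradientBound` this gives the crux with
`γ = (4π/3)(ε/2)³(ε/(2C₁))³`, radius `ρ + 1`. -/
def HotPointNearFixedCentre : Prop :=
  ∀ C : ℝ, 0 < C → ∃ ε : ℝ, 0 < ε ∧ ∃ ρ : ℝ, 0 < ρ ∧
    ∀ (ν T : ℝ), 0 < ν → 0 < T → ∀ (u : ℝ → ℝ³ → ℝ³) (p : ℝ → ℝ³ → ℝ), TypeIData C ν T u p →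
      ¬ HasSmoothExtensionPast ν 0 u T →
      ∃ x₀ : ℝ³, ∀ᶠ t in 𝓝[<] T, ∃ w ∈ Metric.closedBall x₀ (ρ * Real.sqrt (ν * (T - t))),
        ε * Real.sqrt ν ≤ Real.sqrt (T - t) * ‖u t w‖

/-- CARD 2, FIRST LEMMA ("a reach-shielded calm core is a regular point"; sup-norm ε-regularity
under Type-I). For every `C` there are `ε(C) > 0`, `ρ(C) > 0` (`ρ > 2C +` margin: the Lagrangian
reach `∫_t^T ‖u‖_∞ ≤ 2C√(ν(T−t))`) such that if, at one late time `t₁`, velocity AND vorticity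
are `ε`-calm in similarity units on `B(x₀, ρ√(ν(T−t₁)))`, then `u` is bounded on a backward
space–time neighbourhood of `(T, x₀)`, i.e. `(T, x₀)` is regular. Proof route: fluid from outside
the ball never enters `B(x₀,(ρ−2C−m)√(ν(T−t₁)))` (reach); vorticity has no action at a distance,
so in that fixed physical ball `|ω|` is a subsolution of a drift–diffusion equation whose
stretching coefficient (harmonic exterior strain `≲ C/(ρ′ r √(T−t))` + small self-strain) is
time-integrable ⇒ core vorticity stays bounded; then core velocity bounded (local Biot–Savart +
far-field pressure impulse controlled using finite energy, a qualitative input allowed here). -/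
def CalmCoreRegularity : Prop :=
  ∀ C : ℝ, 0 < C → ∃ ε : ℝ, 0 < ε ∧ ∃ ρ : ℝ, 0 < ρ ∧
    ∀ (ν T : ℝ), 0 < ν → 0 < T → ∀ (u : ℝ → ℝ³ → ℝ³) (p : ℝ → ℝ³ → ℝ), TypeIData C ν T u p →
      ∀ᶠ t₁ in 𝓝[<] T, ∀ x₀ : ℝ³,
        (∀ x ∈ Metric.ball x₀ (ρ * Real.sqrt (ν * (T - t₁))),
            Real.sqrt (T - t₁) * ‖u t₁ x‖ ≤ ε * Real.sqrt ν ∧ (T - t₁) * ‖curl (u t₁) x‖ ≤ ε) →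
        ∃ r : ℝ, 0 < r ∧ ∃ M : ℝ, ∀ t ∈ Set.Ico t₁ T, ∀ x ∈ Metric.ball x₀ r, ‖u t x‖ ≤ M

/-- CARD 2, support ("vorticity floor", Leray's rate for `‖ω‖_∞` under Type-I): at a genuine
Type-I(`C`) blow-up the scale-invariant vorticity maximum stays above `ε_ω(C) > 0` at every late
time. Proof route: `w(t) := (T−t)‖ω(t)‖_∞` obeys `w′ ≤ (w/(T−t))(−1 + c w log(C₂(C)/w))`
(maximum principle for the vorticity equation, log-Lipschitz Biot–Savart bound with the Type-I
`C²`-seminorm), so once `w < ε_ω` it stays small, the enstrophy then grows slower than Leray's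
necessary rate `‖∇u(t)‖₂² ≳ ν^{3/2}(T−t)^{-1/2}` / the vorticity stays bounded (BKM), and the
solution would extend past `T`. Needed only by the "vorticity-hot" variant of the assembly. -/
def TypeIVorticityFloor : Prop :=
  ∀ C : ℝ, 0 < C → ∃ εω : ℝ, 0 < εω ∧
    ∀ (ν T : ℝ), 0 < ν → 0 < T → ∀ (u : ℝ → ℝ³ → ℝ³) (p : ℝ → ℝ³ → ℝ), TypeIData C ν T u p →
      ¬ HasSmoothExtensionPast ν 0 u T →
      ∀ᶠ t in 𝓝[<] T, ∃ x : ℝ³, εω ≤ (T - t) * ‖curl (u t) x‖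

/-- Shape check only: the crux decl is in scope under its route name. -/
example : Prop := Summit.NavierStokesRegularity.NavierStokesRegularity.Theses.TypeICertificateLadder.TypeIConcentration

/-- Internal consistency check (pure logic): PROP M implies hot-spot confinement. -/
theorem hotSpotConfinement_of_calmCorePersistence (h : CalmCorePersistence) : HotSpotConfinement := by
  intro C hC η hη
  obtain ⟨ε, hε, ρ, hρ, H⟩ := h C hC η hη
  refine ⟨ε, hε, ρ, hρ, ?_⟩
  intro ν T hν hT u p hdata
  filter_upwards [H ν T hν hT u p hdata] with t₁ ht₁
  intro t ht z hz
  by_contra hno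
  push_neg at hno
  have hcalm : ∀ x ∈ Metric.ball z (ρ * Real.sqrt (ν * (T - t₁))),
      Real.sqrt (T - t₁) * ‖u t₁ x‖ ≤ ε * Real.sqrt ν := fun x hx => hno x hx
  have hzin : z ∈ Metric.ball z (ρ / 2 * Real.sqrt (ν * (T - t))) := by
    refine Metric.mem_ball_self ?_
    have : 0 < T - t := by linarith [ht.2]
    positivity
  have := ht₁ z hcalm t ht z hzin
  linarith

end Summit.NavierStokesRegularity.NavierStokesRegularity.Cruxes.TypeIConcentration.Sketch
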